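import Literature.Probability.LatticeModels.DobrushinComparisonMetric
import Mathlib.Analysis.SpecificLimits.Basic
import HarnessLib

/-!
# Dobrushin's comparison theorem with DEFECTS, Vasserstein form (abstract part)

`DobrushinComparisonMetric.lean` formalises the comparison argument of Dobrushin (1970) /
Föllmer (1988, Ch. I) in the Kantorovich–Rubinstein ("Vasserstein") form for TWO INVARIANT
states `E₁, E₂` of the same single-site averaging operators (defect `b ≡ 0`): the constant
vector `R` is an estimate, the dusting step improves estimates, and iterating gives
`|E₁ f - E₂ f| ≤ R cⁿ ∑ δ` and uniqueness.

Föllmer's Comparison Theorem (2.8) is more general: the second functional need NOT be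
invariant. If `E₂` is merely a state (monotone-normalised) whose **defect** at the usable
site `x` is controlled by a vector `b ≥ 0`,

  `|E₂ (T x f) - E₂ f| ≤ b x · δ_x(f)`   (admissible `f`, `δ` a Lipschitz bound of `f`),

then the dusting step becomes `a ↦ (C a)_x + b_x` at `x` (Föllmer 1988, Ch. I, proof of
Lemma (2.5) with the extra term of (2.8): "`a ↦ aC + b`"), the iterates from `a⁰ = R` are
estimates, and they are dominated by `R cⁿ + d` for every **super-solution** `d ≥ 0` of
`b + C d ≤ d`; hence, when the row sums are `≤ c < 1`,

  `|E₁ f - E₂ f| ≤ ∑_{y ∈ Δ} d y · δ y`      (`abs_sub_le_sum_of_superSolution`),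

which for `d = (∑ₙ Cⁿ) b = D b` is exactly (2.8)/(2.10): `|μ f - μ̃ f| ≤ ∑_y (δ(f) D)_y b_y`.
In applications `E₁` is the expectation under a Gibbs measure `μ` (invariant by the DLR
equations), `E₂` the expectation under an ARBITRARY probability `μ̃`, `T x` the one-site kernel of
the specification, and `b x = sup_ξ W₁(γ_x(·|ξ), μ̃_x(·|ξ))` (or its `μ̃`-average) the Vasserstein
distance between the kernel and the one-site conditional law of `μ̃` — e.g. `μ̃` a tilt
`e^{εG}μ/Z`, which yields Föllmer's covariance estimate with one-site dual norms of `G`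
(the form used by the vertex-star window bound of the venture `YMGap`, where `d = (I - C̄)⁻¹ b`
for an `8 × 8` matrix `C̄`).

This file is again pure bookkeeping over `DobrushinMetric.DustingData` (no measure theory).

## Contents
* `IsState` — a monotone-normalised functional (`inf f ≤ E f ≤ sup f`); every invariant state is one;
* `HasDefect E b` — the defect hypothesis at usable sites;
* `isEstimate_const_of_isState` — `R` is an estimate for any two states;
* `IsEstimate.update_defect`, `IsEstimate.update_min_defect` — the dusting step with defect;
* `phiDefect` (`a ↦ C a + b` on `W`), `IsEstimate.phiDefect`, `isEstimate_iterate_phiDefect`;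
* `iterate_phiDefect_le_of_superSolution` — `Φ_bⁿ R ≤ R cⁿ + d` for `b + C d ≤ d`, all sites usable;
* `abs_sub_le_sum_pow_add_of_superSolution`, `abs_sub_le_sum_of_superSolution` — the comparison
  theorem with defects (Föllmer 1988, Ch. I, (2.8) in the Vasserstein form of Remark (2.17)).

## References
* H. Föllmer, *Random fields and diffusion processes*, École d'Été de Probabilités de
  Saint-Flour XV–XVII (1985–87), LNM 1362, Springer (1988), Ch. I, Lemma (2.5), Comparison
  Theorem (2.8), (2.10), Remark (2.17) with (2.18)–(2.22).
* R. L. Dobrushin, *Prescribing a system of random variables by conditional distributions*,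
  Theory Probab. Appl. 15 (1970) 458–486, Thm. 3.
* H.-O. Georgii, *Gibbs Measures and Phase Transitions*, 2nd ed. (de Gruyter 2011), Thm. 8.20
  (the total-variation version with defects).
-/

open Finset Function

namespace Literature.Probability.LatticeModels

namespace DobrushinMetric

namespace DustingData

variable {V S : Type*} [DecidableEq V] {D : DustingData V S}
variable {E₁ E₂ : ((V → S) → ℝ) → ℝ}

/-! ### States and defects -/

variable (D) in
/-- A **state** for the dusting data: a functional on admissible observables with
`inf f ≤ E f ≤ sup f` (e.g. the expectation under ANY probability measure). Invariance under the
averaging operators is NOT required (Föllmer 1988, Ch. I, (2.8): the compared measure `μ̃` is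
arbitrary). [cite: Follmer1988, Ch. I Comparison Theorem (2.8)] -/
structure IsState (E : ((V → S) → ℝ) → ℝ) : Prop where
  /-- `E f ≤ sup f` -/
  le_of_forall_le : ∀ {f : (V → S) → ℝ} {Δ : Finset V} {M : ℝ}, D.P f Δ → (∀ σ, f σ ≤ M) → E f ≤ M
  /-- `inf f ≤ E f` -/
  ge_of_forall_ge : ∀ {f : (V → S) → ℝ} {Δ : Finset V} {m : ℝ}, D.P f Δ → (∀ σ, m ≤ f σ) → m ≤ E f

/-- An invariant state is a state (Föllmer 1988, Ch. I: the Gibbs state `μ` is one of the two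
compared measures in (2.8)). [cite: Follmer1988, Ch. I Comparison Theorem (2.8)] -/
theorem IsInvariantState.isState {E : ((V → S) → ℝ) → ℝ} (h : D.IsInvariantState E) :
    D.IsState E :=
  ⟨fun hf hM => h.le_of_forall_le hf hM, fun hf hm => h.ge_of_forall_ge hf hm⟩

variable (D) in
/-- **Defect vector** of a functional with respect to the averaging operators (Föllmer 1988,
Ch. I, (2.8): `b_k ≥` the Vasserstein distance between the one-site kernel and the one-site
conditional law of `μ̃`, which gives `|μ̃(π_k f) - μ̃(f)| ≤ b_k δ_k(f)`): for every usable `x` and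
every admissible `f` with Lipschitz bound `δ`, `|E (T x f) - E f| ≤ b x · δ x`.
[cite: Follmer1988, Ch. I Comparison Theorem (2.8)] -/
def HasDefect (E : ((V → S) → ℝ) → ℝ) (b : V → ℝ) : Prop :=
  ∀ ⦃f : (V → S) → ℝ⦄ ⦃Δ : Finset V⦄ ⦃δ : V → ℝ⦄ (x : V), x ∈ D.W → D.P f Δ →
    IsLipBound D.r f δ → |E (D.T x f) - E f| ≤ b x * δ x

/-- An invariant state has defect `0` (the case `μ̃ ∈ G(γ)` of (2.8), i.e. the uniqueness theorem
(2.9)). [cite: Follmer1988, Ch. I Comparison Theorem (2.8)] -/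
theorem IsInvariantState.hasDefect_zero {E : ((V → S) → ℝ) → ℝ} (h : D.IsInvariantState E) :
    D.HasDefect E fun _ => 0 := by
  intro f Δ δ x hx hf _
  rw [h.apply_T x hx hf, sub_self, abs_zero, zero_mul]

/-! ### The constant estimate and the dusting step with defect -/

/-- **The constant vector `R` is an estimate for any two states** (Föllmer 1988, Ch. I, (2.22):
`|E₁ f - E₂ f| ≤ sup f - inf f ≤ R ∑ δ` by the interpolation bound; invariance is not used).
[cite: Follmer1988, Ch. I (2.22)] -/
theorem isEstimate_const_of_isState (h₁ : D.IsState E₁) (h₂ : D.IsState E₂) :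
    D.IsEstimate E₁ E₂ fun _ => D.R := by
  intro f Δ δ hf hδ _
  have hB : ∀ σ τ, f σ ≤ f τ + D.R * ∑ y ∈ Δ, δ y := fun σ τ => by
    have h := abs_sub_le_mul_sum_of_dependsOn D.r_le (D.dependsOn_of hf) hδ σ τ
    linarith [(abs_le.1 h).2]
  have h12 : E₁ f ≤ E₂ f + D.R * ∑ y ∈ Δ, δ y := h₁.le_of_forall_le hf fun σ => by
    have : f σ - D.R * ∑ y ∈ Δ, δ y ≤ E₂ f := h₂.ge_of_forall_ge hf fun τ => by linarith [hB σ τ]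
    linarith
  have h21 : E₂ f ≤ E₁ f + D.R * ∑ y ∈ Δ, δ y := h₂.le_of_forall_le hf fun σ => by
    have : f σ - D.R * ∑ y ∈ Δ, δ y ≤ E₁ f := h₁.ge_of_forall_ge hf fun τ => by linarith [hB σ τ]
    linarith
  rw [← Finset.mul_sum, abs_le]
  constructor <;> linarith

/-- **Dusting step with defect** (Föllmer 1988, Ch. I, proof of Lemma (2.5) combined with the
defect term of (2.8)): if `a ≥ 0` is an estimate for `E₁` invariant and `E₂` with defect `b`, and
`x` is usable, then replacing `a x` by `(C a)_x + b x` gives an estimate: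
`|E₁ f - E₂ f| ≤ |E₁ (T x f) - E₂ (T x f)| + |E₂ (T x f) - E₂ f|`, the first term by the old
estimate applied to `T x f` and dusting, the second by the defect.
[cite: Follmer1988, Ch. I Comparison Theorem (2.8)] -/
theorem IsEstimate.update_defect (h₁ : D.IsInvariantState E₁) {b : V → ℝ} (hb : D.HasDefect E₂ b)
    {a : V → ℝ} (ha : D.IsEstimate E₁ E₂ a) (ha0 : ∀ y, 0 ≤ a y) {x : V} (hx : x ∈ D.W) :
    D.IsEstimate E₁ E₂ (Function.update a x (D.rowC a x + b x)) := by
  intro f Δ δ hf hδ hδ0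
  obtain ⟨Δ', hf'⟩ := D.exists_of x hx hf
  have hδ' := (D.dust x hx hf hδ).restrict (D.dependsOn_of hf')
  have key := ha hf' hδ' fun y hy => if_neg hy
  rw [h₁.apply_T x hx hf] at key
  have hdef := hb x hx hf hδ
  have hsum := Dobrushin.DustingData.sum_dust_le x Δ Δ' ha0 hδ.nonneg hδ0 (D.C_nonneg x)
    (D.C_eq_zero x)
  -- the two updated sums differ exactly by the defect term on `Δ`
  have hsplit : ∑ y ∈ Δ, Function.update a x (D.rowC a x + b x) y * δ y =
      (∑ y ∈ Δ, Function.update a x (D.rowC a x) y * δ y) +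
        ∑ y ∈ Δ, (if y = x then b x else 0) * δ y := by
    rw [← Finset.sum_add_distrib]
    refine Finset.sum_congr rfl fun y _ => ?_
    rcases eq_or_ne y x with rfl | hne
    · simp only [Function.update_self, if_true]; ring
    · simp only [Function.update_of_ne hne, if_neg hne]; ring
  have hbx : b x * δ x ≤ ∑ y ∈ Δ, (if y = x then b x else 0) * δ y := by
    by_cases hxΔ : x ∈ Δ
    · rw [Finset.sum_eq_single_of_mem x hxΔ (fun y _ hne => by rw [if_neg hne, zero_mul])]
      simp
    · rw [hδ0 x hxΔ, mul_zero]
      exact Finset.sum_nonneg fun y _ => by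
        split_ifs with h
        · subst h; exact (hxΔ ‹_›).elim
        · rw [zero_mul]
  calc |E₁ f - E₂ f| ≤ |E₁ f - E₂ (D.T x f)| + |E₂ (D.T x f) - E₂ f| := abs_sub_le _ _ _
    _ ≤ (∑ y ∈ Δ, Function.update a x (D.rowC a x) y * δ y) +
          ∑ y ∈ Δ, (if y = x then b x else 0) * δ y := add_le_add (key.trans hsum) (hdef.trans hbx)
    _ = ∑ y ∈ Δ, Function.update a x (D.rowC a x + b x) y * δ y := hsplit.symm

/-- Dusting step with defect, monotone form: replacing `a x` by `min (a x) ((C a)_x + b x)` gives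
an estimate. [cite: Follmer1988, Ch. I Lemma (2.5)] -/
theorem IsEstimate.update_min_defect (h₁ : D.IsInvariantState E₁) {b : V → ℝ}
    (hb : D.HasDefect E₂ b) {a : V → ℝ} (ha : D.IsEstimate E₁ E₂ a) (ha0 : ∀ y, 0 ≤ a y) {x : V}
    (hx : x ∈ D.W) : D.IsEstimate E₁ E₂ (Function.update a x (min (a x) (D.rowC a x + b x))) := by
  rcases le_total (a x) (D.rowC a x + b x) with h | h
  · rw [min_eq_left h, Function.update_eq_self]
    exact ha
  · rw [min_eq_right h]
    exact ha.update_defect h₁ hb ha0 hx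

/-! ### The simultaneous improvement map with defect and its iterates -/

variable (D) in
/-- The **simultaneous improvement map with defect**: `Φ_b a = C a + b` on `W` and `a` off `W`
(Föllmer 1988, Ch. I, Lemma (2.5)/(2.8): `a ↦ aC + b`). [cite: Follmer1988, Ch. I Comparison Theorem (2.8)] -/
noncomputable def phiDefect (b a : V → ℝ) : V → ℝ :=
  open scoped Classical in fun y => if y ∈ D.W then D.rowC a y + b y else a y

/-- `Φ_b a y = (C a)_y + b y` for usable `y` (the map `a ↦ aC + b` of Lemma (2.5)/(2.8)).
[cite: Follmer1988, Ch. I Lemma (2.5)] -/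
theorem phiDefect_apply_of_mem {b a : V → ℝ} {y : V} (hy : y ∈ D.W) :
    D.phiDefect b a y = D.rowC a y + b y := by
  simp [phiDefect, hy]

/-- `Φ_b a y = a y` off `W` (sites where no averaging is used keep their estimate).
[cite: Follmer1988, Ch. I Lemma (2.5)] -/
theorem phiDefect_apply_of_not_mem {b a : V → ℝ} {y : V} (hy : y ∉ D.W) :
    D.phiDefect b a y = a y := by
  simp [phiDefect, hy]

/-- `Φ_b` preserves nonnegativity when `b ≥ 0` (the iterates `a^{(n)}` of (2.8) are nonnegative
vectors). [cite: Follmer1988, Ch. I Lemma (2.5)] -/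
theorem phiDefect_nonneg {b a : V → ℝ} (hb0 : ∀ y, 0 ≤ b y) (h : ∀ y, 0 ≤ a y) (y : V) :
    0 ≤ D.phiDefect b a y := by
  by_cases hy : y ∈ D.W
  · rw [phiDefect_apply_of_mem hy]; exact add_nonneg (D.rowC_nonneg h y) (hb0 y)
  · rw [phiDefect_apply_of_not_mem hy]; exact h y

/-- **Lemma (2.5) with defect (vector form)**: if `a ≥ 0` is an estimate then so is `Φ_b a` —
sweep the dusting step with defect over the sites of the dependence set, keeping the intermediate
vectors below `a`. [cite: Follmer1988, Ch. I Comparison Theorem (2.8)] -/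
theorem IsEstimate.phiDefect (h₁ : D.IsInvariantState E₁) {b : V → ℝ} (hb : D.HasDefect E₂ b)
    (hb0 : ∀ y, 0 ≤ b y) {a : V → ℝ} (ha : D.IsEstimate E₁ E₂ a) (ha0 : ∀ y, 0 ≤ a y) :
    D.IsEstimate E₁ E₂ (D.phiDefect b a) := by
  intro f Δ δ hf hδ hδ0
  have sweep : ∀ s : Finset V, ∃ e : V → ℝ, D.IsEstimate E₁ E₂ e ∧ (∀ y, 0 ≤ e y) ∧
      (∀ y, e y ≤ a y) ∧ ∀ y ∈ s, y ∈ D.W → e y ≤ D.rowC a y + b y := by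
    intro s
    induction s using Finset.induction_on with
    | empty => exact ⟨a, ha, ha0, fun _ => le_rfl, fun _ h => (Finset.notMem_empty _ h).elim⟩
    | insert x s _ ih =>
      obtain ⟨e, he, he0, hea, hes⟩ := ih
      by_cases hx : x ∈ D.W
      · refine ⟨Function.update e x (min (e x) (D.rowC e x + b x)),
          he.update_min_defect h₁ hb he0 hx, fun y => ?_, fun y => ?_, fun y hy hyW => ?_⟩
        · rcases eq_or_ne y x with rfl | hne
          · rw [Function.update_self]
            exact le_min (he0 _) (add_nonneg (D.rowC_nonneg he0 _) (hb0 _))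
          · rw [Function.update_of_ne hne]; exact he0 y
        · rcases eq_or_ne y x with rfl | hne
          · rw [Function.update_self]; exact (min_le_left _ _).trans (hea _)
          · rw [Function.update_of_ne hne]; exact hea y
        · rcases eq_or_ne y x with rfl | hne
          · rw [Function.update_self]
            exact (min_le_right _ _).trans (by linarith [D.rowC_mono hea y])
          · rw [Function.update_of_ne hne]
            exact hes y ((Finset.mem_insert.1 hy).resolve_left hne) hyW
      · refine ⟨e, he, he0, hea, fun y hy hyW => ?_⟩
        rcases eq_or_ne y x with rfl | hne
        · exact (hx hyW).elim
        · exact hes y ((Finset.mem_insert.1 hy).resolve_left hne) hyW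
  obtain ⟨e, he, -, hea, hes⟩ := sweep Δ
  refine (he hf hδ hδ0).trans (Finset.sum_le_sum fun y hy => ?_)
  refine mul_le_mul_of_nonneg_right ?_ (hδ.nonneg y)
  by_cases hyW : y ∈ D.W
  · rw [phiDefect_apply_of_mem hyW]; exact hes y hy hyW
  · rw [phiDefect_apply_of_not_mem hyW]; exact hea y

/-- All iterates `Φ_bⁿ R` are nonnegative estimates (Föllmer 1988, Ch. I, (2.8): "applying the
lemma successively"). [cite: Follmer1988, Ch. I Comparison Theorem (2.8)] -/
theorem isEstimate_iterate_phiDefect (h₁ : D.IsInvariantState E₁) (h₂ : D.IsState E₂) {b : V → ℝ}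
    (hb : D.HasDefect E₂ b) (hb0 : ∀ y, 0 ≤ b y) (n : ℕ) :
    D.IsEstimate E₁ E₂ ((D.phiDefect b)^[n] fun _ => D.R) ∧
      ∀ y, 0 ≤ ((D.phiDefect b)^[n] fun _ => D.R) y := by
  induction n with
  | zero => exact ⟨isEstimate_const_of_isState h₁.isState h₂, fun _ => D.R_nonneg⟩
  | succ n ih =>
    rw [Function.iterate_succ_apply']
    exact ⟨ih.1.phiDefect h₁ hb hb0 ih.2, phiDefect_nonneg hb0 ih.2⟩

/-- **Domination of the iterates by a super-solution**: if every site is usable, the row sums of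
`C` are `≤ c` with `0 ≤ c`, and `d ≥ 0` satisfies `b + C d ≤ d`, then `Φ_bⁿ R ≤ R cⁿ + d` pointwise
(induction: `C(R cᵏ + d) + b ≤ R cᵏ⁺¹ + (C d + b) ≤ R cᵏ⁺¹ + d`). For `d = (∑ Cⁿ) b` this is
Föllmer's `D b`. [cite: Follmer1988, Ch. I (2.10)] -/
theorem iterate_phiDefect_le_of_superSolution {c : ℝ} (hc0 : 0 ≤ c) (hW : ∀ x, x ∈ D.W)
    (hrow : ∀ x, ∑ y ∈ D.nbr x, D.C x y ≤ c) {b d : V → ℝ} (hd0 : ∀ y, 0 ≤ d y)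
    (hd : ∀ x, b x + D.rowC d x ≤ d x) (n : ℕ) (y : V) :
    ((D.phiDefect b)^[n] fun _ => D.R) y ≤ D.R * c ^ n + d y := by
  induction n generalizing y with
  | zero =>
    simp only [Function.iterate_zero, id_eq, pow_zero, mul_one]
    linarith [hd0 y]
  | succ n ih =>
    rw [Function.iterate_succ_apply', phiDefect_apply_of_mem (hW y)]
    have hsplit : ∑ z ∈ D.nbr y, D.C y z * (D.R * c ^ n + d z) =
        (∑ z ∈ D.nbr y, D.C y z) * (D.R * c ^ n) + D.rowC d y := by
      rw [rowC, Finset.sum_mul, ← Finset.sum_add_distrib]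
      exact Finset.sum_congr rfl fun z _ => by ring
    have hmono : D.rowC ((D.phiDefect b)^[n] fun _ => D.R) y ≤
        ∑ z ∈ D.nbr y, D.C y z * (D.R * c ^ n + d z) :=
      Finset.sum_le_sum fun z _ => mul_le_mul_of_nonneg_left (ih z) (D.C_nonneg y z)
    have hRc : (∑ z ∈ D.nbr y, D.C y z) * (D.R * c ^ n) ≤ c * (D.R * c ^ n) :=
      mul_le_mul_of_nonneg_right (hrow y) (mul_nonneg D.R_nonneg (pow_nonneg hc0 n))
    calc D.rowC ((D.phiDefect b)^[n] fun _ => D.R) y + b y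
        ≤ (∑ z ∈ D.nbr y, D.C y z) * (D.R * c ^ n) + D.rowC d y + b y := by
          linarith [hmono, hsplit]
      _ ≤ c * (D.R * c ^ n) + d y := by linarith [hRc, hd y]
      _ = D.R * c ^ (n + 1) + d y := by ring

/-- **Comparison estimate with defects, finite-step form** (Föllmer 1988, Ch. I, (2.8) with
Remark (2.17)): for `E₁` invariant, `E₂` a state with defect `b ≥ 0`, all sites usable, row sums
`≤ c` (`0 ≤ c`), and a nonnegative super-solution `d` of `b + C d ≤ d`: every admissible `f` with
dependence set `Δ` and Lipschitz bound `δ` vanishing off `Δ` satisfies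
`|E₁ f - E₂ f| ≤ ∑_{y ∈ Δ} (R cⁿ + d y) · δ y` for every `n`.
[cite: Follmer1988, Ch. I Comparison Theorem (2.8)] -/
theorem abs_sub_le_sum_pow_add_of_superSolution (h₁ : D.IsInvariantState E₁) (h₂ : D.IsState E₂)
    {b : V → ℝ} (hb : D.HasDefect E₂ b) (hb0 : ∀ y, 0 ≤ b y) {c : ℝ} (hc0 : 0 ≤ c)
    (hW : ∀ x, x ∈ D.W) (hrow : ∀ x, ∑ y ∈ D.nbr x, D.C x y ≤ c) {d : V → ℝ} (hd0 : ∀ y, 0 ≤ d y)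
    (hd : ∀ x, b x + D.rowC d x ≤ d x) {f : (V → S) → ℝ} {Δ : Finset V} {δ : V → ℝ}
    (hf : D.P f Δ) (hδ : IsLipBound D.r f δ) (hδ0 : ∀ y ∉ Δ, δ y = 0) (n : ℕ) :
    |E₁ f - E₂ f| ≤ ∑ y ∈ Δ, (D.R * c ^ n + d y) * δ y := by
  obtain ⟨hest, -⟩ := isEstimate_iterate_phiDefect h₁ h₂ hb hb0 n
  refine (hest hf hδ hδ0).trans (Finset.sum_le_sum fun y _ => ?_)
  exact mul_le_mul_of_nonneg_right
    (iterate_phiDefect_le_of_superSolution hc0 hW hrow hd0 hd n y) (hδ.nonneg y)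

/-- **Dobrushin's comparison theorem with defects, Vasserstein form** (Föllmer 1988, Ch. I,
Comparison Theorem (2.8) and (2.10) with Remark (2.17); Dobrushin 1970, Thm. 3): under Dobrushin's
condition `c < 1` with all sites usable, for `E₁` invariant (a Gibbs state), `E₂` any state with
defect vector `b ≥ 0`, and any nonnegative `d` with `b + C d ≤ d` (e.g. `d = D b`, `D = ∑ Cⁿ`),
`|E₁ f - E₂ f| ≤ ∑_{y ∈ Δ} d y · δ y` — "`∑_y (δ(f) D)_y b_y`".
[cite: Follmer1988, Ch. I Comparison Theorem (2.8)] -/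
theorem abs_sub_le_sum_of_superSolution (h₁ : D.IsInvariantState E₁) (h₂ : D.IsState E₂)
    {b : V → ℝ} (hb : D.HasDefect E₂ b) (hb0 : ∀ y, 0 ≤ b y) {c : ℝ} (hc0 : 0 ≤ c) (hc1 : c < 1)
    (hW : ∀ x, x ∈ D.W) (hrow : ∀ x, ∑ y ∈ D.nbr x, D.C x y ≤ c) {d : V → ℝ} (hd0 : ∀ y, 0 ≤ d y)
    (hd : ∀ x, b x + D.rowC d x ≤ d x) {f : (V → S) → ℝ} {Δ : Finset V} {δ : V → ℝ}
    (hf : D.P f Δ) (hδ : IsLipBound D.r f δ) (hδ0 : ∀ y ∉ Δ, δ y = 0) :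
    |E₁ f - E₂ f| ≤ ∑ y ∈ Δ, d y * δ y := by
  have hB : ∀ n : ℕ, |E₁ f - E₂ f| ≤ D.R * c ^ n * (∑ y ∈ Δ, δ y) + ∑ y ∈ Δ, d y * δ y := by
    intro n
    refine (abs_sub_le_sum_pow_add_of_superSolution h₁ h₂ hb hb0 hc0 hW hrow hd0 hd hf hδ hδ0 n).trans
      (le_of_eq ?_)
    rw [Finset.mul_sum, ← Finset.sum_add_distrib]
    exact Finset.sum_congr rfl fun y _ => by ring
  have hlim : Filter.Tendsto (fun n : ℕ => D.R * c ^ n * (∑ y ∈ Δ, δ y) + ∑ y ∈ Δ, d y * δ y)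
      Filter.atTop (nhds (0 + ∑ y ∈ Δ, d y * δ y)) := by
    refine Filter.Tendsto.add_const _ ?_
    simpa using ((tendsto_pow_atTop_nhds_zero_of_lt_one hc0 hc1).const_mul D.R).mul_const _
  rw [zero_add] at hlim
  exact ge_of_tendsto' hlim hB

end DustingData

end DobrushinMetric

end Literature.Probability.LatticeModels
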